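import Mathlib

/-!
# EriceRemainderEnclosureHistoryAutonomyComparisonAgeCompositionStaticChainCrossAmplificationsHalf — (E79h) THE COVARIANCE BOUND WITH CONSTANT `1∕2`:
# `|Ψ_yyΨ_zz − Ψ_yzΨ_zy| ≤ (ΔαΔβ∕2)·Ψ_yy²` by centring the observer ratios at the MIDPOINTS of their intervals — the factor that the far pairs
# (`q = y∕z → ∞`) of the observer induction need (with constant `1` the first-order certificate fails for `q ≳ 100`: `ΔαΔβ ≈ 0.29∕√q > (1−κ)α₋β₋ = 0.225∕√q`)

Cell `pub-balaban`, β-function sub-cell, BINDER row D4 «RemainderConst leaves for Bałaban's split» (`HOME/BINDER-OWNERS.md`; owner lineage `b2b-balaban-beta-an4`;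
this file by co-owner #2 lineage `b2b-balaban-beta-d4-p2`, generation 70), β-FLOW TEAM duty (1), FREEZE (0) honoured (def-free, Mathlib only; the letters are those of
(E78h) `…CrossAmplifications.cross_gram_bounds`, which is NOT restated — this is the sharper covariance clause only).

HONEST FRAMING (page 1, verbatim and binding).  *"Discharging BetaPertH makes Bałaban's UV stability UNCONDITIONAL — a real constructive-QFT result; it is
NOT the continuum limit and NOT the Clay problem."*  THIS FILE DISCHARGES NOTHING OF THE KIND.  Finite sums of reals — a hypothesis-free inequality feeding a
census; the age profile of Bałaban's (1.22) limit functional is NOT PRINTED ([I] p. 298; GAPS G-t4-U2-1∕-2) and NOT asserted.  Row D4 class UNCHANGED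
(critical-path width 0; instance 0∕1; D4 DISCHARGE NO DATE).  HONEST DEPENDENCY: continuum YM on T⁴ ⇐ BetaPertH ∧ nine spine estimates (0/9 proved); BetaPertH ⇐
(D1) ∧ (D4) ∧ CAP+tail; G-an2-4 gates asym, D1 and NE2/3/4.

THE POINT (census sense (α); route (N′); README `HOME/b2b-balaban-beta-d4-p2/g70/e79/README.md` §4).  In the generic certificate (E79a) the covariance slack `D`
enters the first-order minorant as `−DΨ²` against the main term `(1−κ)·Ψ·P_zz`.  For FAR pairs (`q = y∕z → ∞`) the observer ratios spread intrinsically: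
`α_k ∈ [1∕q, ≈1.207∕q]`, `β_k ∈ [√q, ≈2.414√q]` over the older ages `k`, so `ΔαΔβ ≈ 0.293∕√q` while `(1−κ)α₋β₋ = 0.225∕√q` — with the constant `1` of (E78h)
the lower `P`-corner of the certificate has a NEGATIVE leading coefficient for every `q ≳ 100` (`g70/numerics/gruss.py`: failures from `(128, 1)` on).  With the
constant `1∕2` of this file (`0.146∕√q < 0.225∕√q`) every far pair computed closes with all coefficients positive (`q` up to `4096`; beyond, only the fixed 4-decimal
rounding of the script gives out).  The proof is (E78h)'s with the shifts taken at the midpoints.  NOT CLAIMED: the sharp Grüss constant `1∕4`; any wiring that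
uses this lemma (the far-band template is successor work); anything printed.

WHAT IS PROVED ([folklore]; 0 `def`, 0 sorry).  **`cross_gram_bounds_half`**.
-/
noncomputable section
open Finset

namespace Summit.QuantumFields.BalabanUV.Beta.EriceRemainderEnclosureHistoryAutonomyComparisonAgeCompositionStaticChainCrossAmplificationsHalf

variable {n : ℕ} {ey cy cz α : ℕ → ℝ} {αl Δα βl Δβ : ℝ}

/-- **THE CROSS GRAM WITH THE HALVED COVARIANCE CONSTANT.**  Letters of (E78h) `cross_gram_bounds`: weights `w_i = e_i·cy_i ≥ 0` (`e_i ≥ 0`, `cy ≥ 0`), charge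
ratios `α_i ∈ [α₋, α₋+Δα]`, response ratios `β₋cy_i ≤ cz_i ≤ (β₋+Δβ)cy_i`; `Ψ_yy = Σe_icy_i`, `Ψ_yz = Σα_ie_icy_i`, `Ψ_zy = Σe_icz_i`, `Ψ_zz = Σα_ie_icz_i`.  Then
**`|Ψ_yyΨ_zz − Ψ_yzΨ_zy| ≤ (ΔαΔβ∕2)·Ψ_yy²`** (vs `ΔαΔβ·Ψ_yy²` in (E78h)): with the MIDPOINTS `α_m = α₋ + Δα∕2`, `β_m = β₋ + Δβ∕2` and `X = Σ(α_i−α_m)e_i(cz_i−β_mcy_i)`,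
`Y = Ψ_yz − α_mΨ_yy`, `Z = Ψ_zy − β_mΨ_yy` one has `Ψ_yyΨ_zz − Ψ_yzΨ_zy = Ψ_yy·X − Y·Z` with `|X| ≤ (ΔαΔβ∕4)Ψ_yy`, `|Y| ≤ (Δα∕2)Ψ_yy`, `|Z| ≤ (Δβ∕2)Ψ_yy`.
(The sharp constant is `1∕4` — Grüss's inequality, via Cauchy–Schwarz and Popoviciu's variance bound; `1∕2` already suffices for every far pair computed,
`g70/numerics/gruss.py`.)  THE USE: the hypothesis `(au − r)(bu − bl) ≤ D` of (E79b) `pair_step_lattice` can be fed with `D` HALVED once the wiring calls this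
lemma — the far `q`-bands of route (N′). [folklore] -/
theorem cross_gram_bounds_half (he : ∀ i, i < n → 0 ≤ ey i) (hcy0 : ∀ i, i < n → 0 ≤ cy i)
    (hα : ∀ i, i < n → αl ≤ α i ∧ α i ≤ αl + Δα)
    (hcz : ∀ i, i < n → βl * cy i ≤ cz i ∧ cz i ≤ (βl + Δβ) * cy i) :
    let Pyy := ∑ i ∈ range n, ey i * cy i
    let Pyz := ∑ i ∈ range n, α i * ey i * cy i
    let Pzy := ∑ i ∈ range n, ey i * cz i
    let Pzz := ∑ i ∈ range n, α i * ey i * cz i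
    Pyy * Pzz - Pyz * Pzy ≤ Δα * Δβ / 2 * Pyy ^ 2 ∧ Pyz * Pzy - Pyy * Pzz ≤ Δα * Δβ / 2 * Pyy ^ 2 := by
  intro Pyy Pyz Pzy Pzz
  -- the centred sums
  set Y := ∑ i ∈ range n, (α i - (αl + Δα / 2)) * (ey i * cy i) with hY
  set Z := ∑ i ∈ range n, ey i * (cz i - (βl + Δβ / 2) * cy i) with hZ
  set X := ∑ i ∈ range n, (α i - (αl + Δα / 2)) * (ey i * (cz i - (βl + Δβ / 2) * cy i)) with hX
  have hw0 : ∀ i ∈ range n, 0 ≤ ey i * cy i := fun i hi => mul_nonneg (he i (mem_range.mp hi)) (hcy0 i (mem_range.mp hi))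
  have hPyy0 : 0 ≤ Pyy := sum_nonneg hw0
  -- identities
  have eY : Pyz = Y + (αl + Δα / 2) * Pyy := by
    simp only [Pyz, hY, Pyy, mul_sum, ← sum_add_distrib]; exact sum_congr rfl fun i _ => by ring
  have eZ : Pzy = Z + (βl + Δβ / 2) * Pyy := by
    simp only [Pzy, hZ, Pyy, mul_sum, ← sum_add_distrib]; exact sum_congr rfl fun i _ => by ring
  have eX : Pzz = X + (αl + Δα / 2) * Z + (βl + Δβ / 2) * Y + (αl + Δα / 2) * (βl + Δβ / 2) * Pyy := by
    simp only [Pzz, hX, hZ, hY, Pyy, mul_sum, ← sum_add_distrib]; exact sum_congr rfl fun i _ => by ring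
  have ecov : Pyy * Pzz - Pyz * Pzy = Pyy * X - Y * Z := by rw [eX, eY, eZ]; ring
  -- ranges: `|Y| ≤ (Δα/2) Pyy`, `|Z| ≤ (Δβ/2) Pyy`, `|X| ≤ (ΔαΔβ/4) Pyy`
  have hYb : |Y| ≤ Δα / 2 * Pyy := by
    rw [hY, show Δα / 2 * Pyy = ∑ i ∈ range n, Δα / 2 * (ey i * cy i) by rw [mul_sum]]
    refine (abs_sum_le_sum_abs _ _).trans (sum_le_sum fun i hi => ?_)
    rw [abs_mul, abs_of_nonneg (hw0 i hi)]
    refine mul_le_mul_of_nonneg_right ?_ (hw0 i hi)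
    have h1 := (hα i (mem_range.mp hi)).1; have h2 := (hα i (mem_range.mp hi)).2
    exact abs_le.mpr ⟨by linarith, by linarith⟩
  have hZb : |Z| ≤ Δβ / 2 * Pyy := by
    rw [hZ, show Δβ / 2 * Pyy = ∑ i ∈ range n, ey i * (Δβ / 2 * cy i) by rw [mul_sum]; exact sum_congr rfl fun i _ => by ring]
    refine (abs_sum_le_sum_abs _ _).trans (sum_le_sum fun i hi => ?_)
    rw [abs_mul, abs_of_nonneg (he i (mem_range.mp hi))]
    refine mul_le_mul_of_nonneg_left ?_ (he i (mem_range.mp hi))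
    have h1 := (hcz i (mem_range.mp hi)).1; have h2 := (hcz i (mem_range.mp hi)).2
    exact abs_le.mpr ⟨by linarith, by linarith⟩
  have hXb : |X| ≤ Δα * Δβ / 4 * Pyy := by
    rw [hX, show Δα * Δβ / 4 * Pyy = ∑ i ∈ range n, Δα / 2 * (ey i * (Δβ / 2 * cy i)) by rw [mul_sum]; exact sum_congr rfl fun i _ => by ring]
    refine (abs_sum_le_sum_abs _ _).trans (sum_le_sum fun i hi => ?_)
    have hi' := mem_range.mp hi
    rw [abs_mul, abs_mul, abs_of_nonneg (he i hi')]
    have h1 := (hα i hi').1; have h2 := (hα i hi').2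
    have h3 := (hcz i hi').1; have h4 := (hcz i hi').2
    have ha : |α i - (αl + Δα / 2)| ≤ Δα / 2 := abs_le.mpr ⟨by linarith, by linarith⟩
    have hc : |cz i - (βl + Δβ / 2) * cy i| ≤ Δβ / 2 * cy i := abs_le.mpr ⟨by linarith, by linarith⟩
    exact mul_le_mul ha (mul_le_mul_of_nonneg_left hc (he i hi')) (mul_nonneg (he i hi') (abs_nonneg _)) (by linarith [abs_nonneg (α i - (αl + Δα / 2))])
  -- `|Pyy X − Y Z| ≤ Pyy|X| + |Y||Z| ≤ (ΔαΔβ/4 + ΔαΔβ/4) Pyy²`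
  have hPX : |Pyy * X| ≤ Δα * Δβ / 4 * Pyy ^ 2 := by
    rw [abs_mul, abs_of_nonneg hPyy0]
    nlinarith [mul_le_mul_of_nonneg_left hXb hPyy0]
  have hYZ : |Y * Z| ≤ Δα * Δβ / 4 * Pyy ^ 2 := by
    rw [abs_mul]
    have := mul_le_mul hYb hZb (abs_nonneg _) (le_trans (abs_nonneg _) hYb)
    nlinarith [this]
  have h1 := abs_le.mp hPX
  have h2 := abs_le.mp hYZ
  constructor
  · rw [ecov]; linarith [h1.2, h2.1]
  · have e : Pyz * Pzy - Pyy * Pzz = -(Pyy * X - Y * Z) := by rw [← ecov]; ring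
    rw [e]; linarith [h1.1, h2.2]

end Summit.QuantumFields.BalabanUV.Beta.EriceRemainderEnclosureHistoryAutonomyComparisonAgeCompositionStaticChainCrossAmplificationsHalf

end
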